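import Literature.MathematicalPhysics.QuantumFieldTheory.Balaban1983to89.Node00.RateRecord11

/-!
# BalabanUVNodes ∕ node N22 = NE9 — A2 SELF-AUDIT OF RECORD (module J91-V): THE LOCATED ROAD-1 SOCKETS' WEIGHT ROWS ARE JOINTLY INCONSISTENT

Cell `pub-ymgap`, HUMAN RULING D-0062 (Track A), R134 seat `pub-ymgap-dag-n22-c` (strategy s1), generation 23, module J91-V.  THEOREMS ONLY (no `def`, no `sorry`,
standard axioms); `--kind proof --supports stmt-QuantumFields-27366 --as helper` (K3⁸), COUNT-NEUTRAL.  Imports only NODE 00's `RateRecord11` (`U3Letters₁₁`, `Signs`).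

WHAT IS AUDITED.  Every LOCATED ROAD-1 socket of this lane — g19 J77 `…TermDataTableGermsRoad1LocatedRadii`, J…`Road1Located`, g20 J81 ∕ J81c ∕ J81m
(`…Road1LocatedRadiiTermSectors ∕ …ContinuedTermSectors ∕ …DilatedMembers`), J81p (`…MembersOfRecord`), g21 J81r (`…MembersOfLocatedRecords`) and the ROAD-1 socket
of record J81s (`…Road1LocatedRadiiMembersOfLemma2Records`, p702588) — displays, among its numeric binders, BOTH
* the WEIGHT FLOOR of node N10's located (2.20) margin (module 107 `termReading226_tableGerms_of_inputs226Holo[_tauRadii]`, level weights `0 < b ≤ bw j` of the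
  table-germ Banach section `cv κ bw`, entering the margin as `E₀ + b⁻¹R`): `(hb : 0 < b) (hbaw : ∀ K k j, b ≤ aw K k j)`, and
* ROAD 1's GEOMETRIC AGE-DECAY of the same weights (the road's fading-memory mechanism since g18 J55 ∕ J61 ∕ J64 ∕ J65): `(hawω : ∀ K k j, j ≤ k → aw K k j ≤ cw * ω₁ ^ (k - j))`
  with `(hω₁μ : ω₁ ≤ μ) (hμω : μ ≤ ℓ.ω)` and `hs : ℓ.Signs` (`ℓ.ω < 1`).
At `j = 0` these give `b ≤ cw·ω₁^k` for every `k`, and `ω₁ < 1` — so `b ≤ 0`: **the numeric antecedent of every located ROAD-1 socket is EMPTY** (the sockets are true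
vacuously; node N27's eight K3⁸ leaves over them inherit the vacuity).  The ROAD-2 sockets (J76 → J89) carry `hawcw : aw ≤ cw` only and are NOT affected (their non-owner
binders are jointly inhabited: module J90 of this generation).

WHY IT IS SUBSTANTIVE, NOT A SLIP OF A SIGN.  In the table-germ currency the older-coupling history enters through the Banach section's level weights; node N10's located
(2.20) needs them bounded BELOW uniformly in the age (else the admissible histories in the section's ball are unbounded and the margin `E₀ + b⁻¹R ≤ ι.w` is lost), while
ROAD 1 («first order only, no N18») asks them to DECAY geometrically in the age — this is the lane's own audit of record J37 (`…N22ModuliDominationAudit`, p621720: «a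
(β′)-letter table UNIFORM in the age cannot be dominated by `ℓ.moduli`») biting one level down.  Repair inside ROAD 1 at the located level: none found (a level-wise margin
`E₀ + (aw K k j)⁻¹R` grows geometrically in the run length and undoes the decay); the fading rate must come from the kernels (node N18's step rate) — ROAD 2.

* §1 `weightFloor_geomDecay_false` — the real-number core: `0 < b`, `b ≤ aw K k j`, `aw K k j ≤ cw·ω₁^(k−j)` (`j ≤ k`), `ω₁ < 1` ⊢ `False`.
* §2 ★ `road1Located_weightRows_false` — the same on the socket's binders VERBATIM (`ℓ : U3Letters₁₁`, `hs : ℓ.Signs`, `hb hbaw hawω hω₁μ hμω` as displayed by J81s).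

HONEST FRAMING (binding).  An A2 (vacuity) finding on THIS LANE's located ROAD-1 sockets, kernel-checked; it retracts nothing that was claimed (every such file is headed
«LOCATED (hypothesis form); N22 NOT discharged») but it says those eight theorems and the eight K3⁸ leaves over them have NO instance; the ROAD-1 sockets WITHOUT the weight
floor (g18 J55 ∕ J61 ∕ J64 ∕ J65, `…GenAnalyticReadingRoad1[Max]`, `…TermDataTableGermsRoad1`, `…Road1Direct`) are not touched by this lemma.  Nothing of Bałaban's is
asserted or denied; N22 NOT discharged; K3⁸ untouched; counts unmoved; one finite 𝕋⁴ programme at fixed ε — NOTHING about the continuum, ℝ⁴, OS, a mass gap or Clay.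
References (TYPES only): [II] = Bałaban, CMP 116 (1988) (2.13)–(2.14) pp. 14–15, (2.20) p. 16, (2.40)–(2.41) p. 21; [I] = CMP 109 (1987) (1.20)–(1.22) p. 264.
-/

namespace YMDAG.N22.KernelFading

open Literature.MathematicalPhysics.QuantumFieldTheory.Balaban1983to89.Node00 (U3Letters₁₁)

/-! ## §1 The real-number core -/

/-- **A POSITIVE AGE-UNIFORM FLOOR UNDER GEOMETRICALLY DECAYING WEIGHTS IS IMPOSSIBLE**: if `0 < b ≤ aw K k j ≤ cw·ω₁^(k−j)` for all `j ≤ k` and `ω₁ < 1`, then `False`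
(take `j = 0` and `k` with `ω₁^k < b∕cw`; the displayed sign `0 ≤ ω₁` is not even needed).  Elementary; the core of the A2 audit of the located ROAD-1 sockets.
[cite: Balaban1987RG1, (1.20)–(1.22) p.264 (hypothesis dictionary; bookkeeping)] -/
theorem weightFloor_geomDecay_false {b cw ω₁ : ℝ} {aw : ℕ → ℕ → ℕ → ℝ} (hb : 0 < b) (hbaw : ∀ K k j, b ≤ aw K k j)
    (hawω : ∀ K k j, j ≤ k → aw K k j ≤ cw * ω₁ ^ (k - j)) (hω₁1 : ω₁ < 1) : False := by
  -- at `j = k = 0`: `b ≤ cw`, so `cw > 0`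
  have hcw : 0 < cw := by
    have h := (hbaw 0 0 0).trans (hawω 0 0 0 le_rfl)
    rw [Nat.sub_zero, pow_zero, mul_one] at h
    exact hb.trans_le h
  -- at `j = 0`: `b ≤ cw·ω₁^k` for every `k`; pick `k` with `ω₁^k < b∕cw`
  obtain ⟨n, hn⟩ := exists_pow_lt_of_lt_one (div_pos hb hcw) hω₁1
  have h := (hbaw 0 n 0).trans (hawω 0 n 0 (Nat.zero_le n))
  rw [Nat.sub_zero] at h
  have h' : cw * ω₁ ^ n < b := by
    have := mul_lt_mul_of_pos_left hn hcw
    rwa [mul_div_cancel₀ _ hcw.ne'] at this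
  exact absurd (h.trans_lt h') (lt_irrefl _)

/-! ## §2 ★ The located ROAD-1 sockets' weight rows, verbatim -/

/-- ★ **THE LOCATED ROAD-1 SOCKETS' NUMERIC ANTECEDENT IS EMPTY** — on the binders AS DISPLAYED by the ROAD-1 socket of record J81s
`n22At_u3OfRecord₁₃_of_termDataTableGermsLocatedRadiiMembersOfLemma2RecordsRoad1Max` (and by J77 ∕ J81 ∕ J81c ∕ J81m ∕ J81p ∕ J81r ∕ `…Road1Located`):
`hs : ℓ.Signs` (so `ℓ.ω < 1`), the weight floor `hb : 0 < b`, `hbaw : ∀ K k j, b ≤ aw K k j` (node N10's located (2.20) margin) and ROAD 1's age-decay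
`hawω : ∀ K k j, j ≤ k → aw K k j ≤ cw * ω₁ ^ (k - j)`, `hω₁μ : ω₁ ≤ μ`, `hμω : μ ≤ ℓ.ω` ⊢ `False` (the displayed `hω₁ : 0 ≤ ω₁` is not used).  A2 audit of record (this lane's own sockets);
the ROAD-2 sockets carry `hawcw : aw ≤ cw` only and are consistent (module J90).
[cite: Balaban1988RG2Cluster, (2.20) p.16 and (2.40)–(2.41) p.21 (the objects; bookkeeping)] -/
theorem road1Located_weightRows_false (ℓ : U3Letters₁₁) (hs : ℓ.Signs) {b cw ω₁ μ : ℝ} {aw : ℕ → ℕ → ℕ → ℝ} (hb : 0 < b)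
    (hbaw : ∀ K k j, b ≤ aw K k j) (hawω : ∀ K k j, j ≤ k → aw K k j ≤ cw * ω₁ ^ (k - j)) (hω₁μ : ω₁ ≤ μ) (hμω : μ ≤ ℓ.ω) : False :=
  weightFloor_geomDecay_false hb hbaw hawω ((hω₁μ.trans hμω).trans_lt hs.ω_lt_one)

end YMDAG.N22.KernelFading
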